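import Summits.AtomisticToContinuum.HydrodynamicLimit.Theorems.InformationPercolationEngineChaosClosesEulerReductionEuler
import Summits.AtomisticToContinuum.HydrodynamicLimit.Theorems.InformationPercolationEngineChaosClosesEulerReductionFields
import HarnessLib

/-!
# Kinetic reduction (crux `ChaosClosesEuler`, stmt-AtomisticToContinuum-15141, line `Sketch`,
# stub `stub_kineticReduction`) — helper: measurability of the mixed integrands on a time strip

WHAT. The integrands of the momentum residual (H2) and of the entropy functional (H3) of the BF18 shell along ONE
good orbit are finite sums of products of two kinds of scalar factors: classical factors (the Euler fields and their
first derivatives, read at shifted times `s + e`, continuous on the strip `[0, b] × 𝕋³` when `0 ≤ e`, `b + e < T`)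
and orbit factors (the cone fields `ρ_r, m_r, e_r, M, θ_r` of `Φₛz`, jointly measurable in `(s, x)`, and `χ(ρ_r)` for
`χ` continuous on `(0, ∞)`). This file lists, for both kinds, a.e. strong measurability for the strip measure
`(vol|[0,b]) ⊗ vol` and measurability of the sections at every `s ∈ [0, b]` — the two measurability inputs of the
kinetic domination lemma `spaceTime_bounds` — and assembles them for the four integrands of (H2).

No named fact is invoked.
-/

noncomputable section

namespace Summit.AtomisticToContinuum.HydrodynamicLimit.Theorems.ChaosClosesEulerReduction

open scoped BigOperators Topology Classical MeasureTheory ENNReal InnerProductSpace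
open Filter Set MeasureTheory Function
open Literature.MathematicalPhysics.KineticTheory
open Literature.Analysis.FluidPDE
open Literature.Analysis.FunctionSpaces
open Summit.AtomisticToContinuum.HydrodynamicLimit.Theorems.LocalSecondLawNegative
open Summit.AtomisticToContinuum.HydrodynamicLimit.Theorems.LocalSecondLawLedger
open Summit.AtomisticToContinuum.HydrodynamicLimit.Theorems.LocalSecondLawLedger.L (Mmom)

variable {N : ℕ}

/-! ## §1 Scalar factors -/

/-- A function continuous on `(0, ∞)` read at a nonnegative measurable argument is measurable (`a ↦ χ |a|` is
continuous off `0`). [folklore] -/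
theorem measurable_comp_nonneg {α : Type*} [MeasurableSpace α] {χe : ℝ → ℝ} (hχ : ContinuousOn χe (Ioi 0))
    {f : α → ℝ} (hf : Measurable f) (hf0 : ∀ a, 0 ≤ f a) : Measurable fun a => χe (f a) := by
  have hg : Measurable fun c : ℝ => χe |c| := by
    refine measurable_of_continuousOn_compl_singleton 0 ?_
    exact hχ.comp continuous_abs.continuousOn fun c hc => abs_pos.2 hc
  have heq : (fun a => χe (f a)) = (fun c : ℝ => χe |c|) ∘ f := by
    funext a; simp [abs_of_nonneg (hf0 a)]
  rw [heq]; exact hg.comp hf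

/-- **Classical factors at shifted times are jointly continuous on a strip**: if `f` is continuous on `[0, T) × 𝕋³`,
`0 ≤ a + e` and `b + e < T`, then `(s, x) ↦ f(s + e, x)` is continuous on `[a, b] × 𝕋³`. [folklore] -/
theorem continuousOn_shift_strip {G : Type*} [TopologicalSpace G] {T : ℝ} {f : ℝ → T3 → G}
    (hf : ContinuousOn (uncurry f) (Ico 0 T ×ˢ univ)) {a b e : ℝ} (ha : 0 ≤ a + e) (hb : b + e < T) :
    ContinuousOn (uncurry fun s x => f (s + e) x) (Icc a b ×ˢ univ) := by
  have hmap : Continuous fun p : ℝ × T3 => (p.1 + e, p.2) := (continuous_fst.add continuous_const).prodMk continuous_snd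
  have heq : (uncurry fun s x => f (s + e) x) = uncurry f ∘ fun p : ℝ × T3 => (p.1 + e, p.2) := by
    funext p; rfl
  rw [heq]
  exact hf.comp hmap.continuousOn fun p hp => ⟨⟨by linarith [hp.1.1], by linarith [hp.1.2]⟩, mem_univ _⟩

/-- **A classical scalar or vector factor on the strip**: a.e. strongly measurable for the strip measure and with
continuous sections. [folklore] -/
theorem classical_factor {G : Type*} [NormedAddCommGroup G] {b : ℝ} {f : ℝ → T3 → G}
    (hf : ContinuousOn (uncurry f) (Icc 0 b ×ˢ univ)) :
    AEStronglyMeasurable (uncurry f) ((volume.restrict (Icc 0 b)).prod volume) ∧ ∀ s ∈ Icc 0 b, Continuous (f s) := by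
  refine ⟨ChaosClosesEulerReadout.aestronglyMeasurable_uncurry_of_continuousOn hf, fun s hs => ?_⟩
  exact hf.comp_continuous (continuous_const.prodMk continuous_id) fun x => ⟨hs, mem_univ x⟩

/-- **An orbit scalar or vector factor on the strip**: a.e. strongly measurable for the strip measure and with
measurable sections. [folklore] -/
theorem orbit_factor {G : Type*} [NormedAddCommGroup G] [MeasurableSpace G] [BorelSpace G] [SecondCountableTopology G]
    {g : ℝ × T3 → G} (hg : Measurable g) (b : ℝ) :
    AEStronglyMeasurable g ((volume.restrict (Icc 0 b)).prod volume) ∧ ∀ s : ℝ, Measurable fun x => g (s, x) :=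
  ⟨hg.aestronglyMeasurable, fun _ => hg.comp (measurable_const.prodMk measurable_id)⟩

/-! ## §2 The factor lists along one orbit -/

section Strip

variable {σ : ℝ} (Φ : HardSphereFlow (Torus.geometry (Fin 3)) (hsDiameter σ N) (N + 1)) {z : Phase N}

/-- **The orbit factors.** Joint measurability of `ρ_r, m_r, e_r, M, θ_r` read along a good orbit, and of `χ(ρ_r)`
for `χ` continuous on `(0, ∞)`. [folklore] -/
theorem orbit_factors (hz : z ∈ Φ.good) {r : ℝ} (hr : 0 < r) {χe : ℝ → ℝ} (hχ : ContinuousOn χe (Ioi 0)) :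
    Measurable (fun p : ℝ × T3 => rhoC r (Φ.flow p.1 z) p.2) ∧
    Measurable (fun p : ℝ × T3 => momC r (Φ.flow p.1 z) p.2) ∧
    (∀ k : Fin 3, Measurable (fun p : ℝ × T3 => momC r (Φ.flow p.1 z) p.2 k)) ∧
    Measurable (fun p : ℝ × T3 => kinC r (Φ.flow p.1 z) p.2) ∧
    (∀ i j : Fin 3, Measurable (fun p : ℝ × T3 => Mmom r (Φ.flow p.1 z) p.2 i j)) ∧
    Measurable (fun p : ℝ × T3 => thetaC r (Φ.flow p.1 z) p.2) ∧
    Measurable (fun p : ℝ × T3 => χe (rhoC r (Φ.flow p.1 z) p.2)) := by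
  have hγ : Measurable fun s => Φ.flow s z := (Φ.isTrajectory z hz).measurable_torus
  have mρ := measurable_rhoC_orbit hγ r
  exact ⟨mρ, measurable_momC_orbit hγ r, measurable_momC_apply_orbit hγ r, measurable_kinC_orbit hγ r,
    measurable_Mmom_orbit hγ r, measurable_thetaC_orbit hγ r, measurable_comp_nonneg hχ mρ fun p => rhoC_nonneg hr _ _⟩

/-- **The classical factors of the velocity.** Continuity on the strip `[0, b] × 𝕋³` of `ũ(s+e)`, its components,
`∂ₜũ(s+e)` and `∂ⱼũᵢ(s+e)` (`0 ≤ e`, `b + e < T`). [folklore] -/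
theorem velocity_factors {T : ℝ} {u : ℝ → T3 → V3} (hu : Torus.IsSmoothSpaceTimeOn (Ico 0 T) u) {e b : ℝ}
    (he : 0 ≤ e) (hbe : b + e < T) :
    ContinuousOn (uncurry fun s x => u (s + e) x) (Icc 0 b ×ˢ univ) ∧
    (∀ k : Fin 3, ContinuousOn (uncurry fun s x => u (s + e) x k) (Icc 0 b ×ˢ univ)) ∧
    ContinuousOn (uncurry fun s x => Torus.timeDerivWithin (Ico 0 T) u (s + e) x) (Icc 0 b ×ˢ univ) ∧
    ∀ i j : Fin 3, ContinuousOn (uncurry fun s x => Torus.partialDeriv j (fun y => u (s + e) y i) x) (Icc 0 b ×ˢ univ) := by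
  have h0 : (0 : ℝ) ≤ 0 + e := by linarith
  have cu := continuousOn_shift_strip (continuousOn_uncurry hu) h0 hbe
  refine ⟨cu, fun k => ?_, continuousOn_shift_strip (continuousOn_timeDerivWithin hu) h0 hbe, fun i j =>
    continuousOn_shift_strip (continuousOn_partialDeriv_apply hu j i) h0 hbe⟩
  exact ((EuclideanSpace.proj k : V3 →L[ℝ] ℝ).continuous).comp_continuousOn cu

/-- **The classical factors of a scalar field** (temperature): `θ(s+e)`, `∂ₜθ(s+e)`, `∂ₖθ(s+e)`, `∇θ(s+e)` on the strip.
[folklore] -/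
theorem scalar_factors {T : ℝ} {θ : ℝ → T3 → ℝ} (hθ : Torus.IsSmoothSpaceTimeOn (Ico 0 T) θ) {e b : ℝ}
    (he : 0 ≤ e) (hbe : b + e < T) :
    ContinuousOn (uncurry fun s x => θ (s + e) x) (Icc 0 b ×ˢ univ) ∧
    ContinuousOn (uncurry fun s x => Torus.timeDerivWithin (Ico 0 T) θ (s + e) x) (Icc 0 b ×ˢ univ) ∧
    (∀ k : Fin 3, ContinuousOn (uncurry fun s x => Torus.partialDeriv k (θ (s + e)) x) (Icc 0 b ×ˢ univ)) ∧
    ContinuousOn (uncurry fun s x => Torus.gradient (θ (s + e)) x) (Icc 0 b ×ˢ univ) := by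
  have h0 : (0 : ℝ) ≤ 0 + e := by linarith
  have cD : ∀ k : Fin 3, ContinuousOn (uncurry fun s x => Torus.partialDeriv k (θ (s + e)) x) (Icc 0 b ×ˢ univ) :=
    fun k => continuousOn_shift_strip (continuousOn_partialDeriv hθ k) h0 hbe
  refine ⟨continuousOn_shift_strip (continuousOn_uncurry hθ) h0 hbe,
    continuousOn_shift_strip (continuousOn_timeDerivWithin hθ) h0 hbe, cD, ?_⟩
  have heq : EqOn (uncurry fun s x => Torus.gradient (θ (s + e)) x)
      (fun p : ℝ × T3 => ∑ k : Fin 3, Torus.partialDeriv k (θ (p.1 + e)) p.2 • EuclideanSpace.single k (1 : ℝ))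
      (Icc 0 b ×ˢ univ) := by
    intro p hp
    have hsT : p.1 + e ∈ Ico 0 T := ⟨by linarith [hp.1.1], by linarith [hp.1.2]⟩
    exact gradient_eq_sum_partialDeriv (isContDiff_one_slice hθ hsT) p.2
  refine ContinuousOn.congr ?_ heq
  exact continuousOn_finsetSum _ fun k _ => (cD k).smul continuousOn_const

end Strip

/-! ## §3 The registered sub-goal -/

/-- **Registered sub-goal `stub_reductionStrip` (helper of `stub_kineticReduction`): a function continuous on
`(0, ∞)` read at a nonnegative measurable argument is measurable** — so the band-extension compressibility `χ(ρ_r)` of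
the cone density along an orbit is a measurable space–time factor although `χ` is arbitrary off `(0, ∞)`. [folklore] -/
theorem stub_reductionStrip : ∀ {α : Type} [MeasurableSpace α] {χe : ℝ → ℝ}, ContinuousOn χe (Set.Ioi 0) → ∀ {f : α → ℝ}, Measurable f → (∀ a, 0 ≤ f a) → Measurable fun a => χe (f a) :=
  fun hχ _ hf hf0 => measurable_comp_nonneg hχ hf hf0

end Summit.AtomisticToContinuum.HydrodynamicLimit.Theorems.ChaosClosesEulerReduction

end
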